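import Literature.Analysis.FluidPDE.LittlewoodPaleyFields
import Literature.Analysis.FluidPDE.CriticalSpacesProofs
import Literature.Analysis.FluidPDE.LerayHopf
import HarnessLib

/-!
# The dyadic bridge of the birth line of the crux `TautLoopKelvin.CirculationFloor`

Helper file (supports the crux item `stmt-NavierStokesRegularity-1538`) proving the registered stub
`stub_dyadicBridge` of the birth skeleton `Cruxes/CirculationFloor/Lines/birth.lean` — the
bookkeeping step of the contrapositive chain. The neighbouring stubs produce pointwise bounds on the
FUNCTION-level Littlewood–Paley blocks of the slices of a Leray–Hopf field `u`,
`‖(Δ̇_j u(t))(x)‖ ≤ K 2^j ε` (`blockFn j (u t) = K_j ⋆ u t`; all `t ∈ [0,T)`, all `x`, all `j ≥ J`);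
this file converts them into the hypothesis shape of Cheskidov–Shvydkoy's Lemma 3.2 (tree
`Literature.Analysis.FluidPDE.cheskidov_shvydkoy_dyadic`): the `L²` tempered distributions `U t` of
the slices (`IsLerayHopfOn.memLp`, `Literature.Analysis.FluidPDE.isDistributionOf_toTemperedDistribution`)
satisfy `limsup_{j → ∞} sup_{t ∈ (0,T)} lpBlockWeight (-1) ∞ (U t) j ≤ K ε`, through the dictionary
`Literature.Analysis.FluidPDE.IsDistributionOf.lpBlockWeight_top_eq`
(`lpBlockWeight (-1) ∞ (U t) j = 2^{-j} ‖Δ̇_j u(t)‖_{L^∞}`).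

## Main statements

* `bridge_weight_mul_ofReal`: the `ℝ≥0∞` arithmetic `2^{-j} · (K 2^j ε) = K ε`.
* `bridge_eLpNorm_top_le`: `‖f‖_{L^∞} ≤ C` from an everywhere bound `‖f x‖ ≤ C`.
* `stub_dyadicBridge`: the registered stub, verbatim (last theorem of the file).
-/

noncomputable section

open Set MeasureTheory Filter Topology
open scoped SchwartzMap ENNReal

set_option linter.dupNamespace false

namespace Summit.NavierStokesRegularity.NavierStokesRegularity.Theorems.CirculationFloor.Birth

/-- The `ℝ≥0∞` arithmetic of the bridge: the weight `2^{(j:ℝ)·(-1)} = 2^{-j}` of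
`lpBlockWeight (-1)` cancels the dyadic growth `2^j` of the block bound,
`2^{(j:ℝ)·(-1)} · ofReal (K · 2^j · ε) = ofReal (K ε)`. -/
theorem bridge_weight_mul_ofReal (K ε : ℝ) (j : ℕ) :
    (2 : ℝ≥0∞) ^ ((((j : ℤ) : ℝ)) * (-1)) * ENNReal.ofReal (K * (2 : ℝ) ^ j * ε) =
      ENNReal.ofReal (K * ε) := by
  have h2 : (2 : ℝ≥0∞) ^ ((((j : ℤ) : ℝ)) * (-1)) = ((2 : ℝ≥0∞) ^ j)⁻¹ := by
    rw [Int.cast_natCast, mul_neg_one, ENNReal.rpow_neg, ENNReal.rpow_natCast]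
  have h3 : ENNReal.ofReal (K * (2 : ℝ) ^ j * ε) = (2 : ℝ≥0∞) ^ j * ENNReal.ofReal (K * ε) := by
    rw [show K * (2 : ℝ) ^ j * ε = (2 : ℝ) ^ j * (K * ε) by ring,
      ENNReal.ofReal_mul (by positivity), ENNReal.ofReal_pow zero_le_two, ENNReal.ofReal_ofNat]
  rw [h2, h3, ← mul_assoc, ENNReal.inv_mul_cancel (pow_ne_zero _ two_ne_zero)
    (ENNReal.pow_ne_top ENNReal.ofNat_ne_top), one_mul]

/-- `‖f‖_{L^∞(μ)} ≤ C` from an everywhere bound `‖f x‖ ≤ C` (Mathlib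
`eLpNormEssSup_le_of_ae_bound` through `ae_of_all`). -/
theorem bridge_eLpNorm_top_le {α F : Type*} [MeasurableSpace α] {μ : Measure α}
    [NormedAddCommGroup F] {f : α → F} {C : ℝ} (h : ∀ x, ‖f x‖ ≤ C) :
    eLpNorm f ∞ μ ≤ ENNReal.ofReal C := by
  rw [eLpNorm_exponent_top]
  exact eLpNormEssSup_le_of_ae_bound (Eventually.of_forall h)

/-- **stub B — `stub_dyadicBridge` (S–M; bookkeeping).** For a Leray–Hopf field `u` on `[0,T]` (so
`u t ∈ L²` for `t ∈ [0,T]`, `IsLerayHopfOn.memLp`) whose slices satisfy the pointwise block bounds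
`‖(Δ̇_j u(t))(x)‖ ≤ K 2^j ε` for all `t ∈ [0,T)`, all `x` and all `j ≥ J`: the `L²` tempered
distributions `U t` of the slices (`Literature.Analysis.FluidPDE.isDistributionOf_toTemperedDistribution`,
extended by `0` off `[0,T]`) satisfy Cheskidov–Shvydkoy's smallness in the `≤` form,
`limsup_{j→∞} sup_{t∈(0,T)} 2^{-j}‖Δ̇_j U(t)‖_∞ ≤ K ε`: for `t ∈ (0,T) ⊆ [0,T) ∩ [0,T]` and `j ≥ J`,
`lpBlockWeight (-1) ∞ (U t) j = 2^{-j} ‖blockFn j (u t)‖_∞ ≤ 2^{-j} · K 2^j ε = K ε`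
(`IsDistributionOf.lpBlockWeight_top_eq`), so the supremum over `t` is `≤ K ε` eventually in `j`. -/
theorem stub_dyadicBridge :
    ∀ (ν T : ℝ), 0 < T → ∀ (u : ℝ → EuclideanSpace ℝ (Fin 3) → EuclideanSpace ℝ (Fin 3)),
      Literature.Analysis.FluidPDE.IsLerayHopfOn T ν 0 (u 0) u →
      ∀ (K ε : ℝ) (J : ℕ), 0 ≤ K → 0 ≤ ε →
        (∀ t ∈ Set.Ico 0 T, ∀ j : ℕ, J ≤ j → ∀ x : EuclideanSpace ℝ (Fin 3),
          ‖Literature.Analysis.FunctionSpaces.blockFn (j : ℤ) (u t) x‖ ≤ K * (2 : ℝ) ^ j * ε) →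
        ∃ U : ℝ → TemperedDistribution (EuclideanSpace ℝ (Fin 3)) (EuclideanSpace ℂ (Fin 3)),
          (∀ t ∈ Set.Icc 0 T, Literature.Analysis.FluidPDE.IsDistributionOf (u t) (U t)) ∧
          Filter.limsup (fun j : ℕ => ⨆ t ∈ Set.Ioo 0 T,
              Literature.Analysis.FunctionSpaces.lpBlockWeight (-1) ⊤ (U t) (j : ℤ)) Filter.atTop ≤
            ENNReal.ofReal (K * ε) := by
  intro ν T _ u hLH K ε J _ _ hb
  haveI : Fact (1 ≤ (2 : ℝ≥0∞)) := ⟨one_le_two⟩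
  -- the `L²` distributions of the slices, extended by `0` off `[0, T]`
  obtain ⟨U, hU⟩ :
      ∃ U : ℝ → TemperedDistribution (EuclideanSpace ℝ (Fin 3)) (EuclideanSpace ℂ (Fin 3)),
        U = fun t => if ht : t ∈ Set.Icc 0 T then
          Lp.toTemperedDistribution
            ((Literature.Analysis.FluidPDE.memLp_complexify_comp (hLH.memLp t ht)).toLp _)
          else 0 :=
    ⟨_, rfl⟩
  have hUt : ∀ t (ht : t ∈ Set.Icc 0 T), U t = Lp.toTemperedDistribution
      ((Literature.Analysis.FluidPDE.memLp_complexify_comp (hLH.memLp t ht)).toLp _) := by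
    intro t ht
    rw [hU]
    exact dif_pos ht
  have hUd : ∀ t ∈ Set.Icc 0 T, Literature.Analysis.FluidPDE.IsDistributionOf (u t) (U t) :=
    fun t ht => by
      rw [hUt t ht]
      exact Literature.Analysis.FluidPDE.isDistributionOf_toTemperedDistribution (hLH.memLp t ht)
  refine ⟨U, hUd, limsup_le_of_le (by isBoundedDefault) ?_⟩
  -- eventually in `j` (namely for `j ≥ J`), every `t ∈ (0, T)` has weight `≤ K ε`
  filter_upwards [eventually_ge_atTop J] with j hj
  refine iSup₂_le fun t ht => ?_
  have htc : t ∈ Set.Icc 0 T := ⟨ht.1.le, ht.2.le⟩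
  have hto : t ∈ Set.Ico 0 T := ⟨ht.1.le, ht.2⟩
  rw [(hUd t htc).lpBlockWeight_top_eq (hLH.memLp t htc) (-1) (j : ℤ)]
  exact (mul_le_mul_right (bridge_eLpNorm_top_le (hb t hto j hj)) _).trans_eq
    (bridge_weight_mul_ofReal K ε j)

end Summit.NavierStokesRegularity.NavierStokesRegularity.Theorems.CirculationFloor.Birth
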